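import Summits.HodgeConjecture.HodgeConjecture.Theorems.F0P3cStCharTSWeylHypMeasure   -- ★ p849733 (B) (this seat): radial Weyl formula kit, `isOpen_setOf_isRegularElt_torusU`, `index_…_eq_two`, radial ⇒ Bochner
import HarnessLib

/-!
# F0 · P3c · line LH6 «StCharTS» — «WEYL-HYP★» STAGE (B-jac): FROM THE TUBE JACOBIAN TO THE WEIGHTED WEYL INTEGRATION FORMULA ON THE
# HYPERBOLIC SET OF `U(Φ₃)(L⁺_v)` (the local-to-global step; Harish-Chandra 1970 Lemmas 22 ∕ 42; Rogawski 1990 §12.5 p. 182)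

Cell `pub/hodgecm-mathlib`, crux H413 = `stmt-HodgeConjecture-24833` (lane `--supports`, helper); seat LH2-p02 (g3); second half of the desk heir's deal
(F0P3-plan (g14) 2026-09-02T05:48:05Z: «if the change-of-variables input is not in the tree, take it as ONE explicit hypothesis BY SHAPE and prove the
identity from it»).  Sequel of ★ p849733 (radial form, unconditional).  THEOREMS ONLY; sorry-free; no definition ∕ instance ∕ notation; axioms TRIO.

THE HYPOTHESIS BY SHAPE (`hJac`, the TUBE JACOBIAN — the one analytic input of the Weyl integration formula, [HarishChandra1970, Lemma 22], [vanDijk1972,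
§2]; NOT in the tree): for ONE measurable `A₀ ⊆ G ⧸ T` of positive finite quotient measure and EVERY measurable `V ⊆ T^{reg}` that is `W`-FREE
(`t, t′ ∈ V ⇒ t′ ≠ w t w⁻¹`, `w` the Weyl element), the Haar measure of the tube `Φ(A₀ × V) = {x t x⁻¹ | xT ∈ A₀, t ∈ V}` is `μ₀(A₀) · ∫_V D dtm` for a given
measurable weight `D : T → ℝ≥0` (print: `D(t) = |D_G(t)| = |det(1 − Ad t)_{𝔤∕𝔱}|`, van Dijk's weight; any `D` here).  It is LOCAL (tubes over small `V`), the
conclusion GLOBAL; for `D = |D_G|` it is a true statement of `p`-adic analysis, so nothing vacuous is assumed, and nothing here pretends to prove it.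

THE RESULTS.
* §1 (generic measure theory) **`restrict_eq_restrict_of_forall_nhds`** — two measures whose restrictions agree near every point of a measurable set `S` of a
  second-countable space agree on `S` (countable subcover, `Measure.restrict_biUnion_congr`).
* §2 (CM, `v` non-split) **`lintegral_hypSet_eq_of_tubeJacobian`** — under `hJac`: for every Borel `f ≥ 0`,
  **`2 · ∫⁻_Ω f dν = ∫⁻_{t ∈ T^{reg}} D(t) · (∫⁻_{G⧸T} f(Φ(q,t)) dμ₀(q)) dtm(t)`**, i.e. the radial measure of ★ p849733 IS `D · tm` on `T^{reg}`.  Proof: take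
  the fibre-count pull-back `μ` of `ν` (★ `exists_measure_apply_eq_lintegral_count_fibre`) and its Weil factorisation `μ = μ₀ ⊗ σ` (★
  `exists_radial_prod_eq_fibreCount_conjFamily`); on a `W`-free regular `V` every fibre of `Φ` meets `A₀ × V` in EXACTLY ONE point (★ (B1) `fibre_dichotomy`), so
  `μ₀(A₀) σ(V) = μ(A₀ × V) = ν(Φ(A₀ × V)) = μ₀(A₀) ∫_V D dtm`; every regular `t₀` has a `W`-free open neighbourhood (`w t₀ w⁻¹ ≠ t₀` because `w ∉ T = Z(t₀)`, ★ (B0)),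
  so §1 gives `σ|_{T^{reg}} = (D · tm)|_{T^{reg}}`, and `σ` is carried by `T^{reg}`.  **`integral_hypSet_eq_of_tubeJacobian`** — the ℂ-valued Bochner form
  `∫_{t ∈ T^{reg}} D(t) • (∫_{G⧸T} g(Φ(q,t)) dμ₀) dtm = 2 • ∫_Ω g dν` for `g` ν-integrable on `Ω` (★ p849733 §2 transport + `integral_withDensity_eq_integral_smul`).

HONEST LABEL: count-neutral; CONDITIONAL on `hJac` (by shape); closes no organ.  HC_CM is proved only modulo the 7 printed citations (2 remaining: hLiu418 =
`stmt-HodgeConjecture-24832`, h413 = `stmt-HodgeConjecture-24833`) until rung 0 closes.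

## References
* [Rogawski1990] J. D. Rogawski, *Automorphic Representations of Unitary Groups in Three Variables*, Ann. of Math. Stud. 123 (1990), §12.5 p. 182.
* [HarishChandra1970] Harish-Chandra, *Harmonic analysis on reductive p-adic groups*, LNM 162 (1970), Lemma 22 (Jacobian of conjugation), Lemma 42.
* [vanDijk1972] G. van Dijk, *Computation of certain induced characters of p-adic groups*, Math. Ann. 199 (1972) 229–240, §2.
* [Weil1965] A. Weil, *Sur la formule de Siegel dans la théorie des groupes classiques*, Acta Math. 113 (1965), n° 49 Lemme 22 (p. 70).
* [Federer1969] H. Federer, *Geometric Measure Theory* (1969), §2.10.10.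
-/

set_option autoImplicit false
set_option linter.dupNamespace false

noncomputable section

open MeasureTheory Measure Set Filter Topology Function NumberField IsDedekindDomain Matrix Polynomial
open Literature.MeasureTheory.Group
open Literature.NumberTheory.Automorphic Literature.NumberTheory.Automorphic.UnitaryGroup Literature.NumberTheory.Rogawski1990
open Summit.HodgeConjecture.HodgeConjecture.Cruxes.H413.F0P3cStCharTSWeylHypFibre
open Summit.HodgeConjecture.HodgeConjecture.Cruxes.H413.F0P3cStCharTSWeylHypNormaliser
open Summit.HodgeConjecture.HodgeConjecture.Cruxes.H413.F0P3cStCharTSWeylHypTorsor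
open Summit.HodgeConjecture.HodgeConjecture.Cruxes.H413.F0P3cStCharTSWeylHypCM
open Summit.HodgeConjecture.HodgeConjecture.Cruxes.H413.F0P3cStCharTSWeylHypMeasure
open scoped ENNReal NNReal MatrixGroups Pointwise

namespace Summit.HodgeConjecture.HodgeConjecture.Cruxes.H413.F0P3cStCharTSWeylHypJacobian

/-! ## §1 Generic: measures that agree near every point of `S` agree on `S` -/

/-- **Local agreement ⇒ agreement on `S`**: in a second-countable space, if every point of the measurable set `S` has an open neighbourhood `U` with
`μ|_{U ∩ S} = ρ|_{U ∩ S}`, then `μ|_S = ρ|_S` (countable subcover; `Measure.restrict_biUnion_congr`). [cite: Federer1969, §2.10.10] -/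
theorem restrict_eq_restrict_of_forall_nhds {α : Type*} [TopologicalSpace α] [SecondCountableTopology α] [MeasurableSpace α]
    [OpensMeasurableSpace α] {μ ρ : Measure α} {S : Set α}
    (h : ∀ x ∈ S, ∃ U : Set α, IsOpen U ∧ x ∈ U ∧ μ.restrict (U ∩ S) = ρ.restrict (U ∩ S)) :
    μ.restrict S = ρ.restrict S := by
  classical
  choose U hUo hxU hU using h
  obtain ⟨C, hCc, hCU⟩ := TopologicalSpace.isOpen_iUnion_countable (fun x : S => U x.1 x.2) fun x => hUo x.1 x.2
  have hcover : S ⊆ ⋃ x ∈ C, U x.1 x.2 := by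
    rw [hCU]; exact fun y hy => mem_iUnion.2 ⟨⟨y, hy⟩, hxU y hy⟩
  have hSU : (⋃ x ∈ C, U x.1 x.2) ∩ S = S := inter_eq_right.2 hcover
  have hmeasU : MeasurableSet (⋃ x ∈ C, U x.1 x.2) := MeasurableSet.biUnion hCc fun x _ => (hUo x.1 x.2).measurableSet
  have key : (μ.restrict S).restrict (⋃ x ∈ C, U x.1 x.2) = (ρ.restrict S).restrict (⋃ x ∈ C, U x.1 x.2) := by
    rw [Measure.restrict_biUnion_congr hCc]
    intro x _
    rw [Measure.restrict_restrict ((hUo x.1 x.2).measurableSet), Measure.restrict_restrict ((hUo x.1 x.2).measurableSet)]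
    exact hU x.1 x.2
  rwa [Measure.restrict_restrict hmeasU, Measure.restrict_restrict hmeasU, hSU] at key

/-! ## §2 The CM carrier: tube Jacobian ⇒ the `D`-weighted Weyl integration formula on the hyperbolic set -/

section CM

variable (L : Type) [Field L] [NumberField L] [IsCMField L] (v : HeightOneSpectrum (𝓞 ↥(maximalRealSubfield L)))

set_option maxHeartbeats 1600000 in
set_option synthInstance.maxHeartbeats 200000 in
-- instance-term unification on the CM local carrier (`quotientMeasure` with its σ-algebra arguments), as in ★ `CMPrincipalSeriesTraceOrbitalForm`
/-- **TUBE JACOBIAN ⇒ WEIGHTED WEYL INTEGRATION FORMULA ON THE HYPERBOLIC SET OF `U(Φ₃)(L⁺_v)`** (`v` non-split; `G`, `T`, `ν`, `tm`, `Φ`, `Ω`, `μ₀ = ν∕tm` as in ★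
`exists_radialMeasure_lintegral_hypSet`; `w` the Weyl element (matrix `Φ₃`); `D : T → ℝ≥0` any measurable weight).  IF for one measurable `A₀ ⊆ G ⧸ T` with
`0 < μ₀(A₀) < ∞` and every measurable `W`-free `V ⊆ T^{reg}` the tube `Φ(A₀ × V)` has Haar measure `μ₀(A₀) · ∫⁻_V D dtm` (the Jacobian of conjugation —
[HarishChandra1970, L. 22]; hypothesis `hJac`, BY SHAPE), THEN for every Borel `f ≥ 0`
**`2 · ∫⁻_Ω f dν = ∫⁻_{t ∈ T^{reg}} D(t) · ∫⁻_{G⧸T} f(Φ(q, t)) dμ₀(q) dtm(t)`** — the fibre-count pull-back `μ₀ ⊗ σ` of `ν` meets `A₀ × V` fibrewise exactly once on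
`W`-free `V` (★ (B1) `fibre_dichotomy`), so `σ = D · tm` near every regular point, hence on `T^{reg}` (§1). [cite: Rogawski1990, §12.5 p. 182]
[cite: HarishChandra1970, Lemma 22; Lemma 42] [cite: vanDijk1972, §2] [cite: Weil1965, n° 49 Lemme 22 (p. 70)] -/
theorem lintegral_hypSet_eq_of_tubeJacobian
    (hns : ∀ w : PlacesOver L v, IsCMField.complexConj L • w.1 = w.1)
    [MeasurableSpace ↥(unitaryGroupOfForm (conjLocal L (IsCMField.complexConj L) v) (cmLocalForm L 3 v))] [BorelSpace ↥(unitaryGroupOfForm (conjLocal L (IsCMField.complexConj L) v) (cmLocalForm L 3 v))] [LocallyCompactSpace ↥(unitaryGroupOfForm (conjLocal L (IsCMField.complexConj L) v) (cmLocalForm L 3 v))] [SecondCountableTopology ↥(unitaryGroupOfForm (conjLocal L (IsCMField.complexConj L) v) (cmLocalForm L 3 v))] [T2Space ↥(unitaryGroupOfForm (conjLocal L (IsCMField.complexConj L) v) (cmLocalForm L 3 v))]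
    [MeasurableSpace (↥(unitaryGroupOfForm (conjLocal L (IsCMField.complexConj L) v) (cmLocalForm L 3 v)) ⧸ (cmBorelTriple L 3 v).M)] [BorelSpace (↥(unitaryGroupOfForm (conjLocal L (IsCMField.complexConj L) v) (cmLocalForm L 3 v)) ⧸ (cmBorelTriple L 3 v).M)]
    (ν : Measure ↥(unitaryGroupOfForm (conjLocal L (IsCMField.complexConj L) v) (cmLocalForm L 3 v))) [ν.IsHaarMeasure] [ν.IsMulRightInvariant]
    (tm : Measure ↥(cmBorelTriple L 3 v).M) [tm.IsMulLeftInvariant] [IsFiniteMeasureOnCompacts tm] [tm.IsOpenPosMeasure] [tm.IsInvInvariant]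
    (Φ : (↥(unitaryGroupOfForm (conjLocal L (IsCMField.complexConj L) v) (cmLocalForm L 3 v)) ⧸ (cmBorelTriple L 3 v).M) × ↥(cmBorelTriple L 3 v).M → ↥(unitaryGroupOfForm (conjLocal L (IsCMField.complexConj L) v) (cmLocalForm L 3 v))) (hΦ : ∀ (x : ↥(unitaryGroupOfForm (conjLocal L (IsCMField.complexConj L) v) (cmLocalForm L 3 v))) (t : ↥(cmBorelTriple L 3 v).M), Φ (QuotientGroup.mk x, t) = x * t * x⁻¹)
    (w : ↥(unitaryGroupOfForm (conjLocal L (IsCMField.complexConj L) v) (cmLocalForm L 3 v))) (hw : Units.val (w : GL (Fin 3) (LocalRing L v)) = cmLocalForm L 3 v)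
    (D : ↥(cmBorelTriple L 3 v).M → ℝ≥0) (hD : Measurable D)
    (hJac : ∃ A₀ : Set (↥(unitaryGroupOfForm (conjLocal L (IsCMField.complexConj L) v) (cmLocalForm L 3 v)) ⧸ (cmBorelTriple L 3 v).M), MeasurableSet A₀ ∧ (quotientMeasure (cmBorelTriple L 3 v).M tm (isClosed_cmBorelTriple_M L v) ν) A₀ ≠ 0 ∧ (quotientMeasure (cmBorelTriple L 3 v).M tm (isClosed_cmBorelTriple_M L v) ν) A₀ ≠ ∞ ∧
      ∀ V : Set ↥(cmBorelTriple L 3 v).M, MeasurableSet V → (∀ t ∈ V, IsRegularElt (((t : ↥(unitaryGroupOfForm (conjLocal L (IsCMField.complexConj L) v) (cmLocalForm L 3 v)))) : GL (Fin 3) (LocalRing L v))) →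
        (∀ t ∈ V, ∀ t' ∈ V, ((t' : ↥(cmBorelTriple L 3 v).M) : ↥(unitaryGroupOfForm (conjLocal L (IsCMField.complexConj L) v) (cmLocalForm L 3 v))) ≠ w * t * w⁻¹) →
          ν (Φ '' (A₀ ×ˢ V)) = (quotientMeasure (cmBorelTriple L 3 v).M tm (isClosed_cmBorelTriple_M L v) ν) A₀ * ∫⁻ t in V, (D t : ℝ≥0∞) ∂tm) :
    ∀ f : ↥(unitaryGroupOfForm (conjLocal L (IsCMField.complexConj L) v) (cmLocalForm L 3 v)) → ℝ≥0∞, Measurable f →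
      2 * ∫⁻ y in {x | ∃ g t : ↥(unitaryGroupOfForm (conjLocal L (IsCMField.complexConj L) v) (cmLocalForm L 3 v)), t ∈ (cmBorelTriple L 3 v).M ∧ IsRegularElt (t : GL (Fin 3) (LocalRing L v)) ∧ g * t * g⁻¹ = x}, f y ∂ν =
        ∫⁻ t in {t : ↥(cmBorelTriple L 3 v).M | IsRegularElt (((t : ↥(unitaryGroupOfForm (conjLocal L (IsCMField.complexConj L) v) (cmLocalForm L 3 v)))) : GL (Fin 3) (LocalRing L v))}, (D t : ℝ≥0∞) * ∫⁻ q, f (Φ (q, t)) ∂(quotientMeasure (cmBorelTriple L 3 v).M tm (isClosed_cmBorelTriple_M L v) ν) ∂tm := by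
  classical
  -- §a data of the carrier (★ (B0)): field-like ring, split form, regular element; `T` closed abelian, `|W| = 2`, centralisers
  haveI : Nontrivial (LocalRing L v) := UnitaryGroup.nontrivial_localRing L v
  have hR : ∀ x : LocalRing L v, x ≠ 0 → IsUnit x := isUnit_of_ne_zero_of_nonsplit L v hns
  have hJ : cmLocalForm L 3 v = (StdForm.antidiagonal 3).over (LocalRing L v) := cmLocalForm_eq_over L 3 v
  have hex := exists_mem_torusU_isRegularElt L v
  have hT := isClosed_cmBorelTriple_M L v
  haveI := hT
  have hTc : ∀ a ∈ (cmBorelTriple L 3 v).M, ∀ b ∈ (cmBorelTriple L 3 v).M, a * b = b * a := fun a ha b hb => mul_comm_of_mem_torusU_cmLocal L v ha hb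
  have hW : (((cmBorelTriple L 3 v).M).subgroupOf (Subgroup.normalizer (((cmBorelTriple L 3 v).M : Subgroup ↥(unitaryGroupOfForm (conjLocal L (IsCMField.complexConj L) v) (cmLocalForm L 3 v))) : Set ↥(unitaryGroupOfForm (conjLocal L (IsCMField.complexConj L) v) (cmLocalForm L 3 v))))).index = 2 :=
    index_torusU_subgroupOf_normalizer_eq_two (conjLocal L (IsCMField.complexConj L) v) hR hJ hex
  have hW0 := ne_of_eq_of_ne hW two_ne_zero
  -- §b topology ∕ measurability: Polish product, `Φ` continuous, `T^{reg}` open, `Ω` and its regular part `D_Ω` Borel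
  haveI : PolishSpace ((↥(unitaryGroupOfForm (conjLocal L (IsCMField.complexConj L) v) (cmLocalForm L 3 v)) ⧸ (cmBorelTriple L 3 v).M) × ↥(cmBorelTriple L 3 v).M) := polishSpace_quotient_prod_subgroup (cmBorelTriple L 3 v).M hT
  have hΦc : Continuous Φ := (continuous_conjFamily_and_smul (cmBorelTriple L 3 v).M Φ hΦ).1
  haveI : SecondCountableTopology ↥(cmBorelTriple L 3 v).M := TopologicalSpace.Subtype.secondCountableTopology _
  haveI : BorelSpace ((↥(unitaryGroupOfForm (conjLocal L (IsCMField.complexConj L) v) (cmLocalForm L 3 v)) ⧸ (cmBorelTriple L 3 v).M) × ↥(cmBorelTriple L 3 v).M) := Prod.borelSpace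
  haveI : T1Space (↥(unitaryGroupOfForm (conjLocal L (IsCMField.complexConj L) v) (cmLocalForm L 3 v)) ⧸ (cmBorelTriple L 3 v).M) := QuotientGroup.instT1Space
  haveI : MeasurableSingletonClass (↥(unitaryGroupOfForm (conjLocal L (IsCMField.complexConj L) v) (cmLocalForm L 3 v)) ⧸ (cmBorelTriple L 3 v).M) := ⟨fun x => isClosed_singleton.measurableSet⟩
  haveI : MeasurableSingletonClass ↥(cmBorelTriple L 3 v).M := ⟨fun x => isClosed_singleton.measurableSet⟩
  haveI : MeasurableSingletonClass ((↥(unitaryGroupOfForm (conjLocal L (IsCMField.complexConj L) v) (cmLocalForm L 3 v)) ⧸ (cmBorelTriple L 3 v).M) × ↥(cmBorelTriple L 3 v).M) :=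
    Prod.instMeasurableSingletonClass
  haveI : SecondCountableTopology (↥(unitaryGroupOfForm (conjLocal L (IsCMField.complexConj L) v) (cmLocalForm L 3 v)) ⧸ (cmBorelTriple L 3 v).M) := (QuotientGroup.isQuotientMap_mk _).secondCountableTopology QuotientGroup.isOpenMap_coe
  haveI : LocallyCompactSpace (↥(unitaryGroupOfForm (conjLocal L (IsCMField.complexConj L) v) (cmLocalForm L 3 v)) ⧸ (cmBorelTriple L 3 v).M) := QuotientGroup.instLocallyCompactSpace _
  haveI : SigmaCompactSpace (↥(unitaryGroupOfForm (conjLocal L (IsCMField.complexConj L) v) (cmLocalForm L 3 v)) ⧸ (cmBorelTriple L 3 v).M) := sigmaCompactSpace_of_locallyCompact_secondCountable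
  haveI : SigmaFinite (quotientMeasure (cmBorelTriple L 3 v).M tm (isClosed_cmBorelTriple_M L v) ν) := SigmaFinite.of_isFiniteMeasureOnCompacts _
  have hSo : IsOpen {t : ↥(cmBorelTriple L 3 v).M | IsRegularElt (((t : ↥(unitaryGroupOfForm (conjLocal L (IsCMField.complexConj L) v) (cmLocalForm L 3 v)))) : GL (Fin 3) (LocalRing L v))} :=
    isOpen_setOf_isRegularElt_torusU (conjLocal L (IsCMField.complexConj L) v) (cmLocalForm L 3 v) hR
  have hSm := hSo.measurableSet
  have hRTΩ : ∀ t : ↥(cmBorelTriple L 3 v).M, (t : ↥(unitaryGroupOfForm (conjLocal L (IsCMField.complexConj L) v) (cmLocalForm L 3 v))) ∈ {x | ∃ g t : ↥(unitaryGroupOfForm (conjLocal L (IsCMField.complexConj L) v) (cmLocalForm L 3 v)), t ∈ (cmBorelTriple L 3 v).M ∧ IsRegularElt (t : GL (Fin 3) (LocalRing L v)) ∧ g * t * g⁻¹ = x} → Subgroup.centralizer ({(t : ↥(unitaryGroupOfForm (conjLocal L (IsCMField.complexConj L) v) (cmLocalForm L 3 v)))} : Set ↥(unitaryGroupOfForm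 (conjLocal L (IsCMField.complexConj L) v) (cmLocalForm L 3 v))) = (cmBorelTriple L 3 v).M := fun t ht =>
    centralizer_eq_cmTorus_of_isRegularElt L v t.2
      (isRegularElt_of_mem_hypSet (conjLocal L (IsCMField.complexConj L) v) (cmLocalForm L 3 v) ht)
  have hRcΩ : ∀ g x : ↥(unitaryGroupOfForm (conjLocal L (IsCMField.complexConj L) v) (cmLocalForm L 3 v)), x ∈ {x | ∃ g t : ↥(unitaryGroupOfForm (conjLocal L (IsCMField.complexConj L) v) (cmLocalForm L 3 v)), t ∈ (cmBorelTriple L 3 v).M ∧ IsRegularElt (t : GL (Fin 3) (LocalRing L v)) ∧ g * t * g⁻¹ = x} → g * x * g⁻¹ ∈ {x | ∃ g t : ↥(unitaryGroupOfForm (conjLocal L (IsCMField.complexConj L) v) (cmLocalForm L 3 v)), t ∈ (cmBorelTriple L 3 v).M ∧ IsRegularElt (t : GL (Fin 3) (LocalRing L v)) ∧ g * t * g⁻¹ = x} :=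
    fun g x hx => conj_mem_hypSet (conjLocal L (IsCMField.complexConj L) v) (cmLocalForm L 3 v) hx g
  have hDΩ : {p : (↥(unitaryGroupOfForm (conjLocal L (IsCMField.complexConj L) v) (cmLocalForm L 3 v)) ⧸ (cmBorelTriple L 3 v).M) × ↥(cmBorelTriple L 3 v).M | ((p.2 : ↥(cmBorelTriple L 3 v).M) : ↥(unitaryGroupOfForm (conjLocal L (IsCMField.complexConj L) v) (cmLocalForm L 3 v))) ∈ {x | ∃ g t : ↥(unitaryGroupOfForm (conjLocal L (IsCMField.complexConj L) v) (cmLocalForm L 3 v)), t ∈ (cmBorelTriple L 3 v).M ∧ IsRegularElt (t : GL (Fin 3) (LocalRing L v)) ∧ g * t * g⁻¹ = x}} = {p | IsRegularElt (((p.2 : ↥(unitaryGroupOfForm (conjLocal L (IsCMField.complexConj L) v) (cmLocalForm L 3 v)))) : GL (Fin 3) (LocalRing L v))} := by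
    ext p
    exact ⟨fun h => isRegularElt_of_mem_hypSet (conjLocal L (IsCMField.complexConj L) v) (cmLocalForm L 3 v) h,
      fun h => mem_hypSet_of_mem_torusU (conjLocal L (IsCMField.complexConj L) v) (cmLocalForm L 3 v) p.2.2 h⟩
  have hDm : MeasurableSet {p : (↥(unitaryGroupOfForm (conjLocal L (IsCMField.complexConj L) v) (cmLocalForm L 3 v)) ⧸ (cmBorelTriple L 3 v).M) × ↥(cmBorelTriple L 3 v).M | ((p.2 : ↥(cmBorelTriple L 3 v).M) : ↥(unitaryGroupOfForm (conjLocal L (IsCMField.complexConj L) v) (cmLocalForm L 3 v))) ∈ {x | ∃ g t : ↥(unitaryGroupOfForm (conjLocal L (IsCMField.complexConj L) v) (cmLocalForm L 3 v)), t ∈ (cmBorelTriple L 3 v).M ∧ IsRegularElt (t : GL (Fin 3) (LocalRing L v)) ∧ g * t * g⁻¹ = x}} := by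
    rw [hDΩ]; exact hSm.preimage measurable_snd
  have hinj := locallyInjOn_conjFamily (cmBorelTriple L 3 v).M hT hTc Φ hΦ {x | ∃ g t : ↥(unitaryGroupOfForm (conjLocal L (IsCMField.complexConj L) v) (cmLocalForm L 3 v)), t ∈ (cmBorelTriple L 3 v).M ∧ IsRegularElt (t : GL (Fin 3) (LocalRing L v)) ∧ g * t * g⁻¹ = x} hRTΩ hW0
  have hΩeq : Φ '' {p : (↥(unitaryGroupOfForm (conjLocal L (IsCMField.complexConj L) v) (cmLocalForm L 3 v)) ⧸ (cmBorelTriple L 3 v).M) × ↥(cmBorelTriple L 3 v).M | ((p.2 : ↥(cmBorelTriple L 3 v).M) : ↥(unitaryGroupOfForm (conjLocal L (IsCMField.complexConj L) v) (cmLocalForm L 3 v))) ∈ {x | ∃ g t : ↥(unitaryGroupOfForm (conjLocal L (IsCMField.complexConj L) v) (cmLocalForm L 3 v)), t ∈ (cmBorelTriple L 3 v).M ∧ IsRegularElt (t : GL (Fin 3) (LocalRing L v)) ∧ g * t * g⁻¹ = x}} = {x | ∃ g t : ↥(unitaryGroupOfForm (conjLocal L (IsCMField.complexConj L) v) (cmLocalForm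 L 3 v)), t ∈ (cmBorelTriple L 3 v).M ∧ IsRegularElt (t : GL (Fin 3) (LocalRing L v)) ∧ g * t * g⁻¹ = x} := by
    ext x
    constructor
    · rintro ⟨⟨q, t⟩, ht, rfl⟩
      obtain ⟨g, rfl⟩ := QuotientGroup.mk_surjective q
      rw [hΦ]
      exact hRcΩ g _ ht
    · rintro ⟨g, t, htT, ht, rfl⟩
      exact ⟨(QuotientGroup.mk g, ⟨t, htT⟩),
        mem_hypSet_of_mem_torusU (conjLocal L (IsCMField.complexConj L) v) (cmLocalForm L 3 v) htT ht, hΦ g ⟨t, htT⟩⟩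
  have hΩm : MeasurableSet {x | ∃ g t : ↥(unitaryGroupOfForm (conjLocal L (IsCMField.complexConj L) v) (cmLocalForm L 3 v)), t ∈ (cmBorelTriple L 3 v).M ∧ IsRegularElt (t : GL (Fin 3) (LocalRing L v)) ∧ g * t * g⁻¹ = x} := by
    rw [← hΩeq, ← Set.univ_inter {p : (↥(unitaryGroupOfForm (conjLocal L (IsCMField.complexConj L) v) (cmLocalForm L 3 v)) ⧸ (cmBorelTriple L 3 v).M) × ↥(cmBorelTriple L 3 v).M | ((p.2 : ↥(cmBorelTriple L 3 v).M) : ↥(unitaryGroupOfForm (conjLocal L (IsCMField.complexConj L) v) (cmLocalForm L 3 v))) ∈ {x | ∃ g t : ↥(unitaryGroupOfForm (conjLocal L (IsCMField.complexConj L) v) (cmLocalForm L 3 v)), t ∈ (cmBorelTriple L 3 v).M ∧ IsRegularElt (t : GL (Fin 3) (LocalRing L v)) ∧ g * t * g⁻¹ = x}}]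
    exact measurableSet_image_inter_of_locallyInjOn hDm hΦc hinj MeasurableSet.univ
  -- §c the fibre-count pull-back `μ` of `ν` and its Weil factorisation `μ = μ₀ ⊗ σ`; the radial formula for this `σ`
  obtain ⟨μ, hμ⟩ := exists_measure_apply_eq_lintegral_count_fibre hDm hΦc hinj ν
  have hw2 : ∀ y ∈ Φ '' {p : (↥(unitaryGroupOfForm (conjLocal L (IsCMField.complexConj L) v) (cmLocalForm L 3 v)) ⧸ (cmBorelTriple L 3 v).M) × ↥(cmBorelTriple L 3 v).M | ((p.2 : ↥(cmBorelTriple L 3 v).M) : ↥(unitaryGroupOfForm (conjLocal L (IsCMField.complexConj L) v) (cmLocalForm L 3 v))) ∈ {x | ∃ g t : ↥(unitaryGroupOfForm (conjLocal L (IsCMField.complexConj L) v) (cmLocalForm L 3 v)), t ∈ (cmBorelTriple L 3 v).M ∧ IsRegularElt (t : GL (Fin 3) (LocalRing L v)) ∧ g * t * g⁻¹ = x}}, Measure.count (Φ ⁻¹' {y} ∩ {p : (↥(unitaryGroupOfForm (conjLocal L (IsCMField.complexConj L) v) (cmLocalForm L 3 v)) ⧸ (cmBorelTriple L 3 v).M)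 × ↥(cmBorelTriple L 3 v).M | ((p.2 : ↥(cmBorelTriple L 3 v).M) : ↥(unitaryGroupOfForm (conjLocal L (IsCMField.complexConj L) v) (cmLocalForm L 3 v))) ∈ {x | ∃ g t : ↥(unitaryGroupOfForm (conjLocal L (IsCMField.complexConj L) v) (cmLocalForm L 3 v)), t ∈ (cmBorelTriple L 3 v).M ∧ IsRegularElt (t : GL (Fin 3) (LocalRing L v)) ∧ g * t * g⁻¹ = x}}) =
      ((((cmBorelTriple L 3 v).M).subgroupOf (Subgroup.normalizer (((cmBorelTriple L 3 v).M : Subgroup ↥(unitaryGroupOfForm (conjLocal L (IsCMField.complexConj L) v) (cmLocalForm L 3 v))) : Set ↥(unitaryGroupOfForm (conjLocal L (IsCMField.complexConj L) v) (cmLocalForm L 3 v))))).index : ℝ≥0∞) :=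
    fun y hy => count_fibre_conjFamily_eq (cmBorelTriple L 3 v).M hTc Φ hΦ {x | ∃ g t : ↥(unitaryGroupOfForm (conjLocal L (IsCMField.complexConj L) v) (cmLocalForm L 3 v)), t ∈ (cmBorelTriple L 3 v).M ∧ IsRegularElt (t : GL (Fin 3) (LocalRing L v)) ∧ g * t * g⁻¹ = x} hRTΩ hRcΩ hW0 hy
  obtain ⟨σ, hσfin, hσsf, hσcar, hprod⟩ :=
    exists_radial_prod_eq_fibreCount_conjFamily (cmBorelTriple L 3 v).M hT hTc ν Φ hΦ {x | ∃ g t : ↥(unitaryGroupOfForm (conjLocal L (IsCMField.complexConj L) v) (cmLocalForm L 3 v)), t ∈ (cmBorelTriple L 3 v).M ∧ IsRegularElt (t : GL (Fin 3) (LocalRing L v)) ∧ g * t * g⁻¹ = x} hΩm hRTΩ hRcΩ hW0 tm hμ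
  haveI := hσsf
  have hformula : ∀ f : ↥(unitaryGroupOfForm (conjLocal L (IsCMField.complexConj L) v) (cmLocalForm L 3 v)) → ℝ≥0∞, Measurable f →
      2 * ∫⁻ y in {x | ∃ g t : ↥(unitaryGroupOfForm (conjLocal L (IsCMField.complexConj L) v) (cmLocalForm L 3 v)), t ∈ (cmBorelTriple L 3 v).M ∧ IsRegularElt (t : GL (Fin 3) (LocalRing L v)) ∧ g * t * g⁻¹ = x}, f y ∂ν = ∫⁻ t, ∫⁻ q, f (Φ (q, t)) ∂(quotientMeasure (cmBorelTriple L 3 v).M tm (isClosed_cmBorelTriple_M L v) ν) ∂σ := by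
    intro f hf
    have h1 := lintegral_comp_eq_mul_setLIntegral_image hDm hΦc hinj hμ hw2 hf
    rw [hW, hΩeq, ← hprod, lintegral_prod_symm (fun z : (↥(unitaryGroupOfForm (conjLocal L (IsCMField.complexConj L) v) (cmLocalForm L 3 v)) ⧸ (cmBorelTriple L 3 v).M) × ↥(cmBorelTriple L 3 v).M => f (Φ z))
      (hf.comp hΦc.measurable).aemeasurable] at h1
    simpa only [Nat.cast_ofNat] using h1.symm
  -- §d evaluation on tubes over `W`-free regular `V`: `σ V = ∫⁻_V D dtm`
  obtain ⟨A₀, hA₀m, hA₀0, hA₀top, hJ'⟩ := hJac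
  have htube : ∀ V : Set ↥(cmBorelTriple L 3 v).M, MeasurableSet V → (∀ t ∈ V, IsRegularElt (((t : ↥(unitaryGroupOfForm (conjLocal L (IsCMField.complexConj L) v) (cmLocalForm L 3 v)))) : GL (Fin 3) (LocalRing L v))) →
      (∀ t ∈ V, ∀ t' ∈ V, ((t' : ↥(cmBorelTriple L 3 v).M) : ↥(unitaryGroupOfForm (conjLocal L (IsCMField.complexConj L) v) (cmLocalForm L 3 v))) ≠ w * t * w⁻¹) → σ V = ∫⁻ t in V, (D t : ℝ≥0∞) ∂tm := by
    intro V hVm hVreg hVfree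
    have hE : MeasurableSet (A₀ ×ˢ V) := hA₀m.prod hVm
    have hEsub : A₀ ×ˢ V ⊆ {p : (↥(unitaryGroupOfForm (conjLocal L (IsCMField.complexConj L) v) (cmLocalForm L 3 v)) ⧸ (cmBorelTriple L 3 v).M) × ↥(cmBorelTriple L 3 v).M | ((p.2 : ↥(cmBorelTriple L 3 v).M) : ↥(unitaryGroupOfForm (conjLocal L (IsCMField.complexConj L) v) (cmLocalForm L 3 v))) ∈ {x | ∃ g t : ↥(unitaryGroupOfForm (conjLocal L (IsCMField.complexConj L) v) (cmLocalForm L 3 v)), t ∈ (cmBorelTriple L 3 v).M ∧ IsRegularElt (t : GL (Fin 3) (LocalRing L v)) ∧ g * t * g⁻¹ = x}} := fun p hp =>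
      mem_hypSet_of_mem_torusU (conjLocal L (IsCMField.complexConj L) v) (cmLocalForm L 3 v) p.2.2 (hVreg p.2 hp.2)
    have hEim : MeasurableSet (Φ '' (A₀ ×ˢ V)) := by
      rw [← inter_eq_left.2 hEsub]; exact measurableSet_image_inter_of_locallyInjOn hDm hΦc hinj hE
    -- every fibre meets `A₀ × V` at most once
    have hsub : ∀ y, (Φ ⁻¹' {y} ∩ (A₀ ×ˢ V ∩ {p : (↥(unitaryGroupOfForm (conjLocal L (IsCMField.complexConj L) v) (cmLocalForm L 3 v)) ⧸ (cmBorelTriple L 3 v).M) × ↥(cmBorelTriple L 3 v).M | ((p.2 : ↥(cmBorelTriple L 3 v).M) : ↥(unitaryGroupOfForm (conjLocal L (IsCMField.complexConj L) v) (cmLocalForm L 3 v))) ∈ {x | ∃ g t : ↥(unitaryGroupOfForm (conjLocal L (IsCMField.complexConj L) v) (cmLocalForm L 3 v)), t ∈ (cmBorelTriple L 3 v).M ∧ IsRegularElt (t : GL (Fin 3) (LocalRing L v)) ∧ g * t * g⁻¹ = x}})).Subsingleton := by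
      rintro y ⟨q, t⟩ ⟨hyq, ⟨⟨-, htV⟩, -⟩⟩ ⟨q', t'⟩ ⟨hyq', ⟨⟨-, ht'V⟩, -⟩⟩
      obtain ⟨g, rfl⟩ := QuotientGroup.mk_surjective q
      obtain ⟨g', rfl⟩ := QuotientGroup.mk_surjective q'
      simp only [mem_preimage, mem_singleton_iff, hΦ] at hyq hyq'
      rcases fibre_dichotomy (conjLocal L (IsCMField.complexConj L) v) hR hJ hw t'.2 (hVreg t' ht'V) t.2 (hVreg t htV)
          (hyq.trans hyq'.symm) with ⟨h1, h2⟩ | ⟨-, h2⟩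
      · refine Prod.ext ?_ (Subtype.ext h2)
        exact (QuotientGroup.eq.2 h1).symm
      · exact absurd h2 (hVfree t' ht'V t htV)
    have hcount : ∀ y, Measure.count (Φ ⁻¹' {y} ∩ (A₀ ×ˢ V ∩ {p : (↥(unitaryGroupOfForm (conjLocal L (IsCMField.complexConj L) v) (cmLocalForm L 3 v)) ⧸ (cmBorelTriple L 3 v).M) × ↥(cmBorelTriple L 3 v).M | ((p.2 : ↥(cmBorelTriple L 3 v).M) : ↥(unitaryGroupOfForm (conjLocal L (IsCMField.complexConj L) v) (cmLocalForm L 3 v))) ∈ {x | ∃ g t : ↥(unitaryGroupOfForm (conjLocal L (IsCMField.complexConj L) v) (cmLocalForm L 3 v)), t ∈ (cmBorelTriple L 3 v).M ∧ IsRegularElt (t : GL (Fin 3) (LocalRing L v)) ∧ g * t * g⁻¹ = x}})) = (Φ '' (A₀ ×ˢ V)).indicator 1 y := by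
      intro y
      by_cases hy : y ∈ Φ '' (A₀ ×ˢ V)
      · obtain ⟨p, hp, rfl⟩ := hy
        have hmem : p ∈ Φ ⁻¹' {Φ p} ∩ (A₀ ×ˢ V ∩ {p : (↥(unitaryGroupOfForm (conjLocal L (IsCMField.complexConj L) v) (cmLocalForm L 3 v)) ⧸ (cmBorelTriple L 3 v).M) × ↥(cmBorelTriple L 3 v).M | ((p.2 : ↥(cmBorelTriple L 3 v).M) : ↥(unitaryGroupOfForm (conjLocal L (IsCMField.complexConj L) v) (cmLocalForm L 3 v))) ∈ {x | ∃ g t : ↥(unitaryGroupOfForm (conjLocal L (IsCMField.complexConj L) v) (cmLocalForm L 3 v)), t ∈ (cmBorelTriple L 3 v).M ∧ IsRegularElt (t : GL (Fin 3) (LocalRing L v)) ∧ g * t * g⁻¹ = x}}) := ⟨rfl, hp, hEsub hp⟩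
        rw [(hsub (Φ p)).eq_singleton_of_mem hmem, Measure.count_singleton, indicator_of_mem (mem_image_of_mem Φ hp),
          Pi.one_apply]
      · have hempty : Φ ⁻¹' {y} ∩ (A₀ ×ˢ V ∩ {p : (↥(unitaryGroupOfForm (conjLocal L (IsCMField.complexConj L) v) (cmLocalForm L 3 v)) ⧸ (cmBorelTriple L 3 v).M) × ↥(cmBorelTriple L 3 v).M | ((p.2 : ↥(cmBorelTriple L 3 v).M) : ↥(unitaryGroupOfForm (conjLocal L (IsCMField.complexConj L) v) (cmLocalForm L 3 v))) ∈ {x | ∃ g t : ↥(unitaryGroupOfForm (conjLocal L (IsCMField.complexConj L) v) (cmLocalForm L 3 v)), t ∈ (cmBorelTriple L 3 v).M ∧ IsRegularElt (t : GL (Fin 3) (LocalRing L v)) ∧ g * t * g⁻¹ = x}}) = ∅ :=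
          eq_empty_of_forall_notMem fun p hp => hy ⟨p, hp.2.1, hp.1⟩
        rw [hempty, measure_empty, indicator_of_notMem hy]
    have hμE : μ (A₀ ×ˢ V) = ν (Φ '' (A₀ ×ˢ V)) := by
      rw [hμ _ hE, lintegral_congr fun y => hcount y, lintegral_indicator_one hEim]
    have hμE' : μ (A₀ ×ˢ V) = (quotientMeasure (cmBorelTriple L 3 v).M tm (isClosed_cmBorelTriple_M L v) ν) A₀ * σ V := by
      rw [← hprod, Measure.prod_prod]
    have h3 := hJ' V hVm hVreg hVfree
    rw [← hμE, hμE'] at h3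
    exact (ENNReal.mul_right_inj hA₀0 hA₀top).1 h3
  -- §e every regular `t₀` has a `W`-free open neighbourhood (`w t₀ w⁻¹ ≠ t₀` since `w ∉ T = Z(t₀)`)
  have hnbhd : ∀ t₀ ∈ {t : ↥(cmBorelTriple L 3 v).M | IsRegularElt (((t : ↥(unitaryGroupOfForm (conjLocal L (IsCMField.complexConj L) v) (cmLocalForm L 3 v)))) : GL (Fin 3) (LocalRing L v))}, ∃ U : Set ↥(cmBorelTriple L 3 v).M, IsOpen U ∧ t₀ ∈ U ∧
      σ.restrict (U ∩ {t : ↥(cmBorelTriple L 3 v).M | IsRegularElt (((t : ↥(unitaryGroupOfForm (conjLocal L (IsCMField.complexConj L) v) (cmLocalForm L 3 v)))) : GL (Fin 3) (LocalRing L v))}) =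
        (tm.withDensity fun t => (D t : ℝ≥0∞)).restrict (U ∩ {t : ↥(cmBorelTriple L 3 v).M | IsRegularElt (((t : ↥(unitaryGroupOfForm (conjLocal L (IsCMField.complexConj L) v) (cmLocalForm L 3 v)))) : GL (Fin 3) (LocalRing L v))}) := by
    intro t₀ ht₀
    have hne : (t₀ : ↥(unitaryGroupOfForm (conjLocal L (IsCMField.complexConj L) v) (cmLocalForm L 3 v))) ≠ w * t₀ * w⁻¹ := by
      intro h
      apply weyl_not_mem_torusU (conjLocal L (IsCMField.complexConj L) v) hJ hw
      have hwZ : w ∈ Subgroup.centralizer ({(t₀ : ↥(unitaryGroupOfForm (conjLocal L (IsCMField.complexConj L) v) (cmLocalForm L 3 v)))} : Set ↥(unitaryGroupOfForm (conjLocal L (IsCMField.complexConj L) v) (cmLocalForm L 3 v))) := by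
        rw [Subgroup.mem_centralizer_iff]
        intro g hg
        rw [mem_singleton_iff.1 hg]
        exact (mul_inv_eq_iff_eq_mul.1 h.symm).symm
      rw [centralizer_eq_cmTorus_of_isRegularElt L v t₀.2 ht₀] at hwZ
      exact hwZ
    obtain ⟨O₁, O₂, hO₁, hO₂, h₁, h₂, hdisj⟩ := t2_separation hne
    have hcont : Continuous fun t : ↥(cmBorelTriple L 3 v).M => w * (t : ↥(unitaryGroupOfForm (conjLocal L (IsCMField.complexConj L) v) (cmLocalForm L 3 v))) * w⁻¹ := (continuous_const.mul continuous_subtype_val).mul continuous_const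
    refine ⟨{t | (t : ↥(unitaryGroupOfForm (conjLocal L (IsCMField.complexConj L) v) (cmLocalForm L 3 v))) ∈ O₁ ∧ w * (t : ↥(unitaryGroupOfForm (conjLocal L (IsCMField.complexConj L) v) (cmLocalForm L 3 v))) * w⁻¹ ∈ O₂}, (hO₁.preimage continuous_subtype_val).inter (hO₂.preimage hcont), ⟨h₁, h₂⟩, ?_⟩
    have hfree : ∀ t ∈ {t : ↥(cmBorelTriple L 3 v).M | (t : ↥(unitaryGroupOfForm (conjLocal L (IsCMField.complexConj L) v) (cmLocalForm L 3 v))) ∈ O₁ ∧ w * (t : ↥(unitaryGroupOfForm (conjLocal L (IsCMField.complexConj L) v) (cmLocalForm L 3 v))) * w⁻¹ ∈ O₂}, ∀ t' ∈ {t : ↥(cmBorelTriple L 3 v).M | (t : ↥(unitaryGroupOfForm (conjLocal L (IsCMField.complexConj L) v) (cmLocalForm L 3 v))) ∈ O₁ ∧ w * (t : ↥(unitaryGroupOfForm (conjLocal L (IsCMField.complexConj L) v) (cmLocalForm L 3 v))) * w⁻¹ ∈ O₂},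
        ((t' : ↥(cmBorelTriple L 3 v).M) : ↥(unitaryGroupOfForm (conjLocal L (IsCMField.complexConj L) v) (cmLocalForm L 3 v))) ≠ w * t * w⁻¹ := fun t ht t' ht' h => hdisj.ne_of_mem ht'.1 ht.2 h
    ext B hB
    have hVm : MeasurableSet (B ∩ ({t : ↥(cmBorelTriple L 3 v).M | (t : ↥(unitaryGroupOfForm (conjLocal L (IsCMField.complexConj L) v) (cmLocalForm L 3 v))) ∈ O₁ ∧ w * (t : ↥(unitaryGroupOfForm (conjLocal L (IsCMField.complexConj L) v) (cmLocalForm L 3 v))) * w⁻¹ ∈ O₂} ∩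
        {t : ↥(cmBorelTriple L 3 v).M | IsRegularElt (((t : ↥(unitaryGroupOfForm (conjLocal L (IsCMField.complexConj L) v) (cmLocalForm L 3 v)))) : GL (Fin 3) (LocalRing L v))})) :=
      hB.inter (((hO₁.preimage continuous_subtype_val).inter (hO₂.preimage hcont)).measurableSet.inter hSm)
    rw [Measure.restrict_apply hB, Measure.restrict_apply hB, withDensity_apply _ hVm]
    exact htube _ hVm (fun t ht => ht.2.2) (fun t ht t' ht' => hfree t ht.2.1 t' ht'.2.1)
  have hident := restrict_eq_restrict_of_forall_nhds hnbhd
  -- §f assembly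
  intro f hf
  have hσS : σ = σ.restrict {t : ↥(cmBorelTriple L 3 v).M | IsRegularElt (((t : ↥(unitaryGroupOfForm (conjLocal L (IsCMField.complexConj L) v) (cmLocalForm L 3 v)))) : GL (Fin 3) (LocalRing L v))} := by
    refine (Measure.restrict_eq_self_of_ae_mem ?_).symm
    rw [ae_iff]
    convert hσcar using 2
    ext t
    simp only [mem_setOf_eq]
    exact not_congr ⟨fun h => mem_hypSet_of_mem_torusU (conjLocal L (IsCMField.complexConj L) v) (cmLocalForm L 3 v) t.2 h,
      fun h => isRegularElt_of_mem_hypSet (conjLocal L (IsCMField.complexConj L) v) (cmLocalForm L 3 v) h⟩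
  have hOm : Measurable fun t : ↥(cmBorelTriple L 3 v).M => ∫⁻ q, f (Φ (q, t)) ∂(quotientMeasure (cmBorelTriple L 3 v).M tm (isClosed_cmBorelTriple_M L v) ν) :=
    Measurable.lintegral_prod_left' (μ := (quotientMeasure (cmBorelTriple L 3 v).M tm (isClosed_cmBorelTriple_M L v) ν)) (hf.comp hΦc.measurable)
  rw [hformula f hf, hσS, hident, restrict_withDensity hSm, lintegral_withDensity_eq_lintegral_mul _
    hD.coe_nnreal_ennreal hOm]
  rfl

set_option maxHeartbeats 1600000 in
set_option synthInstance.maxHeartbeats 200000 in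
-- instance-term unification on the CM local carrier (`quotientMeasure` with its σ-algebra arguments), as in ★ `CMPrincipalSeriesTraceOrbitalForm`
/-- **The Bochner ∕ ℂ-valued form**: under the same tube-Jacobian hypothesis, for every `g : G → ℂ` that is `ν`-integrable on `Ω`,
`(t, q) ↦ g(Φ(q, t))` is integrable for `(D · tm|_{T^{reg}}) ⊗ μ₀` and **`∫_{t ∈ T^{reg}} D(t) • (∫_{G⧸T} g(Φ(q, t)) dμ₀) dtm = 2 • ∫_Ω g dν`**
(★ p849733 §2 `integrable_and_integral_eq_smul_of_lintegral_radial` along the weighted radial identity, then `integral_withDensity_eq_integral_smul`).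
[cite: Rogawski1990, §12.5 p. 182] [cite: HarishChandra1970, Lemma 42] [cite: vanDijk1972, §2] -/
theorem integral_hypSet_eq_of_tubeJacobian
    (hns : ∀ w : PlacesOver L v, IsCMField.complexConj L • w.1 = w.1)
    [MeasurableSpace ↥(unitaryGroupOfForm (conjLocal L (IsCMField.complexConj L) v) (cmLocalForm L 3 v))] [BorelSpace ↥(unitaryGroupOfForm (conjLocal L (IsCMField.complexConj L) v) (cmLocalForm L 3 v))] [LocallyCompactSpace ↥(unitaryGroupOfForm (conjLocal L (IsCMField.complexConj L) v) (cmLocalForm L 3 v))] [SecondCountableTopology ↥(unitaryGroupOfForm (conjLocal L (IsCMField.complexConj L) v) (cmLocalForm L 3 v))] [T2Space ↥(unitaryGroupOfForm (conjLocal L (IsCMField.complexConj L) v) (cmLocalForm L 3 v))]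
    [MeasurableSpace (↥(unitaryGroupOfForm (conjLocal L (IsCMField.complexConj L) v) (cmLocalForm L 3 v)) ⧸ (cmBorelTriple L 3 v).M)] [BorelSpace (↥(unitaryGroupOfForm (conjLocal L (IsCMField.complexConj L) v) (cmLocalForm L 3 v)) ⧸ (cmBorelTriple L 3 v).M)]
    (ν : Measure ↥(unitaryGroupOfForm (conjLocal L (IsCMField.complexConj L) v) (cmLocalForm L 3 v))) [ν.IsHaarMeasure] [ν.IsMulRightInvariant]
    (tm : Measure ↥(cmBorelTriple L 3 v).M) [tm.IsMulLeftInvariant] [IsFiniteMeasureOnCompacts tm] [tm.IsOpenPosMeasure] [tm.IsInvInvariant]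
    (Φ : (↥(unitaryGroupOfForm (conjLocal L (IsCMField.complexConj L) v) (cmLocalForm L 3 v)) ⧸ (cmBorelTriple L 3 v).M) × ↥(cmBorelTriple L 3 v).M → ↥(unitaryGroupOfForm (conjLocal L (IsCMField.complexConj L) v) (cmLocalForm L 3 v))) (hΦ : ∀ (x : ↥(unitaryGroupOfForm (conjLocal L (IsCMField.complexConj L) v) (cmLocalForm L 3 v))) (t : ↥(cmBorelTriple L 3 v).M), Φ (QuotientGroup.mk x, t) = x * t * x⁻¹)
    (w : ↥(unitaryGroupOfForm (conjLocal L (IsCMField.complexConj L) v) (cmLocalForm L 3 v))) (hw : Units.val (w : GL (Fin 3) (LocalRing L v)) = cmLocalForm L 3 v)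
    (D : ↥(cmBorelTriple L 3 v).M → ℝ≥0) (hD : Measurable D)
    (hJac : ∃ A₀ : Set (↥(unitaryGroupOfForm (conjLocal L (IsCMField.complexConj L) v) (cmLocalForm L 3 v)) ⧸ (cmBorelTriple L 3 v).M), MeasurableSet A₀ ∧ (quotientMeasure (cmBorelTriple L 3 v).M tm (isClosed_cmBorelTriple_M L v) ν) A₀ ≠ 0 ∧ (quotientMeasure (cmBorelTriple L 3 v).M tm (isClosed_cmBorelTriple_M L v) ν) A₀ ≠ ∞ ∧
      ∀ V : Set ↥(cmBorelTriple L 3 v).M, MeasurableSet V → (∀ t ∈ V, IsRegularElt (((t : ↥(unitaryGroupOfForm (conjLocal L (IsCMField.complexConj L) v) (cmLocalForm L 3 v)))) : GL (Fin 3) (LocalRing L v))) →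
        (∀ t ∈ V, ∀ t' ∈ V, ((t' : ↥(cmBorelTriple L 3 v).M) : ↥(unitaryGroupOfForm (conjLocal L (IsCMField.complexConj L) v) (cmLocalForm L 3 v))) ≠ w * t * w⁻¹) →
          ν (Φ '' (A₀ ×ˢ V)) = (quotientMeasure (cmBorelTriple L 3 v).M tm (isClosed_cmBorelTriple_M L v) ν) A₀ * ∫⁻ t in V, (D t : ℝ≥0∞) ∂tm)
    (g : ↥(unitaryGroupOfForm (conjLocal L (IsCMField.complexConj L) v) (cmLocalForm L 3 v)) → ℂ) (hg : IntegrableOn g {x | ∃ g t : ↥(unitaryGroupOfForm (conjLocal L (IsCMField.complexConj L) v) (cmLocalForm L 3 v)), t ∈ (cmBorelTriple L 3 v).M ∧ IsRegularElt (t : GL (Fin 3) (LocalRing L v)) ∧ g * t * g⁻¹ = x} ν) :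
    Integrable (fun p : ↥(cmBorelTriple L 3 v).M × (↥(unitaryGroupOfForm (conjLocal L (IsCMField.complexConj L) v) (cmLocalForm L 3 v)) ⧸ (cmBorelTriple L 3 v).M) => g (Φ (p.2, p.1)))
        (((tm.restrict {t : ↥(cmBorelTriple L 3 v).M | IsRegularElt (((t : ↥(unitaryGroupOfForm (conjLocal L (IsCMField.complexConj L) v) (cmLocalForm L 3 v)))) : GL (Fin 3) (LocalRing L v))}).withDensity fun t => (D t : ℝ≥0∞)).prod (quotientMeasure (cmBorelTriple L 3 v).M tm (isClosed_cmBorelTriple_M L v) ν)) ∧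
      ∫ t in {t : ↥(cmBorelTriple L 3 v).M | IsRegularElt (((t : ↥(unitaryGroupOfForm (conjLocal L (IsCMField.complexConj L) v) (cmLocalForm L 3 v)))) : GL (Fin 3) (LocalRing L v))}, (D t : ℝ) • ∫ q, g (Φ (q, t)) ∂(quotientMeasure (cmBorelTriple L 3 v).M tm (isClosed_cmBorelTriple_M L v) ν) ∂tm =
        (2 : ℝ) • ∫ y in {x | ∃ g t : ↥(unitaryGroupOfForm (conjLocal L (IsCMField.complexConj L) v) (cmLocalForm L 3 v)), t ∈ (cmBorelTriple L 3 v).M ∧ IsRegularElt (t : GL (Fin 3) (LocalRing L v)) ∧ g * t * g⁻¹ = x}, g y ∂ν := by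
  have hmain := lintegral_hypSet_eq_of_tubeJacobian L v hns ν tm Φ hΦ w hw D hD hJac
  haveI : Nontrivial (LocalRing L v) := UnitaryGroup.nontrivial_localRing L v
  have hR : ∀ x : LocalRing L v, x ≠ 0 → IsUnit x := isUnit_of_ne_zero_of_nonsplit L v hns
  have hSm := (isOpen_setOf_isRegularElt_torusU (conjLocal L (IsCMField.complexConj L) v) (cmLocalForm L 3 v) hR).measurableSet
  haveI : SecondCountableTopology ↥(cmBorelTriple L 3 v).M := TopologicalSpace.Subtype.secondCountableTopology _
  haveI : BorelSpace ((↥(unitaryGroupOfForm (conjLocal L (IsCMField.complexConj L) v) (cmLocalForm L 3 v)) ⧸ (cmBorelTriple L 3 v).M) × ↥(cmBorelTriple L 3 v).M) := Prod.borelSpace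
  haveI : SecondCountableTopology (↥(unitaryGroupOfForm (conjLocal L (IsCMField.complexConj L) v) (cmLocalForm L 3 v)) ⧸ (cmBorelTriple L 3 v).M) := (QuotientGroup.isQuotientMap_mk _).secondCountableTopology QuotientGroup.isOpenMap_coe
  haveI : LocallyCompactSpace (↥(unitaryGroupOfForm (conjLocal L (IsCMField.complexConj L) v) (cmLocalForm L 3 v)) ⧸ (cmBorelTriple L 3 v).M) := QuotientGroup.instLocallyCompactSpace _
  haveI : SigmaCompactSpace (↥(unitaryGroupOfForm (conjLocal L (IsCMField.complexConj L) v) (cmLocalForm L 3 v)) ⧸ (cmBorelTriple L 3 v).M) := sigmaCompactSpace_of_locallyCompact_secondCountable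
  haveI : SigmaFinite (quotientMeasure (cmBorelTriple L 3 v).M tm (isClosed_cmBorelTriple_M L v) ν) := SigmaFinite.of_isFiniteMeasureOnCompacts _
  haveI : LocallyCompactSpace ↥(cmBorelTriple L 3 v).M := (isClosed_cmBorelTriple_M L v).isClosedEmbedding_subtypeVal.locallyCompactSpace
  haveI : SigmaCompactSpace ↥(cmBorelTriple L 3 v).M := sigmaCompactSpace_of_locallyCompact_secondCountable
  haveI : SigmaFinite tm := SigmaFinite.of_isFiniteMeasureOnCompacts _
  haveI : SigmaFinite ((tm.restrict {t : ↥(cmBorelTriple L 3 v).M | IsRegularElt (((t : ↥(unitaryGroupOfForm (conjLocal L (IsCMField.complexConj L) v) (cmLocalForm L 3 v)))) : GL (Fin 3) (LocalRing L v))}).withDensity fun t => (D t : ℝ≥0∞)) :=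
    SigmaFinite.withDensity_of_ne_top (ae_of_all _ fun _ => ENNReal.coe_ne_top)
  have hΦm : Measurable Φ := (continuous_conjFamily_and_smul (cmBorelTriple L 3 v).M Φ hΦ).1.measurable
  have hDm' : Measurable fun t : ↥(cmBorelTriple L 3 v).M => (D t : ℝ≥0∞) := hD.coe_nnreal_ennreal
  have hmain' : ∀ f : ↥(unitaryGroupOfForm (conjLocal L (IsCMField.complexConj L) v) (cmLocalForm L 3 v)) → ℝ≥0∞, Measurable f → ((2 : ℕ) : ℝ≥0∞) * ∫⁻ y in {x | ∃ g t : ↥(unitaryGroupOfForm (conjLocal L (IsCMField.complexConj L) v) (cmLocalForm L 3 v)), t ∈ (cmBorelTriple L 3 v).M ∧ IsRegularElt (t : GL (Fin 3) (LocalRing L v)) ∧ g * t * g⁻¹ = x}, f y ∂ν =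
      ∫⁻ t, ∫⁻ q, f (Φ (q, t)) ∂(quotientMeasure (cmBorelTriple L 3 v).M tm (isClosed_cmBorelTriple_M L v) ν) ∂((tm.restrict {t : ↥(cmBorelTriple L 3 v).M | IsRegularElt (((t : ↥(unitaryGroupOfForm (conjLocal L (IsCMField.complexConj L) v) (cmLocalForm L 3 v)))) : GL (Fin 3) (LocalRing L v))}).withDensity
        fun t => (D t : ℝ≥0∞)) := by
    intro f hf
    have hOm : Measurable fun t : ↥(cmBorelTriple L 3 v).M =>
        ∫⁻ q, f (Φ (q, t)) ∂(quotientMeasure (cmBorelTriple L 3 v).M tm (isClosed_cmBorelTriple_M L v) ν) :=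
      Measurable.lintegral_prod_left' (μ := (quotientMeasure (cmBorelTriple L 3 v).M tm (isClosed_cmBorelTriple_M L v) ν)) (hf.comp hΦm)
    rw [Nat.cast_ofNat, hmain f hf, lintegral_withDensity_eq_lintegral_mul _ hDm' hOm]
    rfl
  obtain ⟨hint, heq⟩ := integrable_and_integral_eq_smul_of_lintegral_radial hΦm hmain' g hg
  refine ⟨hint, ?_⟩
  rw [Nat.cast_ofNat] at heq
  rw [← heq, integral_withDensity_eq_integral_smul hD]
  rfl

end CM

end Summit.HodgeConjecture.HodgeConjecture.Cruxes.H413.F0P3cStCharTSWeylHypJacobian
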